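/-
Copyright (c) 2026 the pub-hodgecm-mathlib formalisation cell (harness21).  Prover seat hodgecm-mathlib-F0P2-p10 (g3), cross-line hand at the S2 desk
(chair K2-lead (g2) VALVE 16 (o); S2 dealer K2E1b-plan (g8) CARD 6 «Haar along the factorisation», 2026-09-05T02:07:39Z).
THEOREMS ONLY (no `def`, no `instance`, no notation, no named-fact hypothesis, no `sorry`).
-/
import Literature.NumberTheory.Automorphic.UnitaryGroupArchimedeanPlaces   -- ★ `archLocal`, `archPiEquivCM`
import Mathlib.MeasureTheory.Measure.Haar.Unique
import Mathlib.MeasureTheory.Constructions.Pi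
import HarnessLib

/-!
# R90 ∕ S2 — `R90S2ArchHaarProduct`: HAAR MEASURE ALONG THE FACTORISATION `U(H)(L ⊗ ℝ) ≃ₜ* Π_w U(σ_w H)(ℂ)`

Cell `hodgecm-mathlib`, sub-problem h413 = `stmt-HodgeConjecture-24833` (helper lane `--supports … --as helper`, count-neutral); squad R90, section S2
(«S2∕C11», dealer K2E1b-plan (g8)); prover F0P2-p10 (g3).

WHAT.  Generic §1: for a topological-group isomorphism `e : Γ ≃ₜ* Π i, G i` onto a FINITE product of second-countable locally compact groups,
(H1) the pull-back `(⊗ᵢ νᵢ).map e⁻¹` of a product of Haar measures is a Haar measure on `Γ`; (H2) `νΓ.map e = ⊗ νᵢ ↔ νΓ = (⊗ νᵢ).map e⁻¹`;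
(H3) **every Haar measure `νΓ` on `Γ` is, along `e`, a product of Haar measures**: `νΓ.map e = ⊗ᵢ ν′ᵢ` with each `ν′ᵢ` Haar (uniqueness of Haar measure up to a
positive scalar on the second-countable locally compact group `Π G i`, the scalar absorbed into one factor: `⊗ (update ν i₀ (c • ν i₀)) = c • ⊗ ν`); (H5) right
invariance is transported along `e⁻¹`.  §2: the instances at `e := archPiEquivCM L H` (★ `UnitaryGroupArchimedeanPlaces`), the factorisation of the
archimedean unitary group of a CM hermitian space over its complex places — the hypothesis of the S2 tensor letters' `G`-instance (`ArchTensorRepLettersG`).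
[Folland1995, §2.2 (2.20), Thm. 2.20] [Bourbaki INT VII §1 no. 2].
HONEST LABEL.  Haar bookkeeping pays no printed input; `HC_CM` is proved only modulo the 7 printed citations (2 remaining named inputs: hLiu418 =
`stmt-HodgeConjecture-24832`, h413 = `stmt-HodgeConjecture-24833`) until rung 0 closes.

## References
* [Folland1995] G. B. Folland, *A Course in Abstract Harmonic Analysis* (1995): §2.2 (2.20), Thm. 2.20 (existence and uniqueness of Haar measure).
* [BourbakiINT7] N. Bourbaki, *Intégration*, Ch. VII §1 no. 2 (Haar measure on products).
-/

set_option autoImplicit false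
set_option linter.dupNamespace false -- the mandated namespace repeats `HodgeConjecture.HodgeConjecture`

noncomputable section

open scoped Classical NNReal ENNReal
open MeasureTheory MeasureTheory.Measure NumberField NumberField.InfinitePlace
open Literature.NumberTheory.Automorphic Literature.NumberTheory.Automorphic.UnitaryGroup

namespace Summit.HodgeConjecture.HodgeConjecture.R90.S2

/-! ## §1 Generic: Haar measures along an isomorphism onto a finite product -/

section Generic

variable {ι : Type*} [Fintype ι] {G : ι → Type*}
  [∀ i, Group (G i)] [∀ i, TopologicalSpace (G i)] [∀ i, IsTopologicalGroup (G i)]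
  [∀ i, MeasurableSpace (G i)] [∀ i, BorelSpace (G i)] [∀ i, SecondCountableTopology (G i)]
  {Γ : Type*} [Group Γ] [TopologicalSpace Γ] [IsTopologicalGroup Γ] [MeasurableSpace Γ] [BorelSpace Γ]

omit [∀ i, Group (G i)] [∀ i, TopologicalSpace (G i)] [∀ i, IsTopologicalGroup (G i)] [∀ i, BorelSpace (G i)] [∀ i, SecondCountableTopology (G i)] in
/-- **the product measure with one factor rescaled**: `⊗ (update ν i₀ (c • ν i₀)) = c • ⊗ ν`. [cite: BourbakiINT7, Ch. VII §1 no. 2] -/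
theorem pi_update_smul (ν : ∀ i, Measure (G i)) [∀ i, SigmaFinite (ν i)] (i₀ : ι) (c : ℝ≥0∞)
    [∀ i, SigmaFinite (Function.update ν i₀ (c • ν i₀) i)] :
    Measure.pi (Function.update ν i₀ (c • ν i₀)) = c • Measure.pi ν := by
  refine Measure.pi_eq fun s _ => ?_
  rw [Measure.smul_apply, Measure.pi_pi, smul_eq_mul]
  have hsplit := fun (g : ι → ℝ≥0∞) => Finset.mul_prod_erase (Finset.univ : Finset ι) g (Finset.mem_univ i₀)
  rw [← hsplit (fun i => ν i (s i)), ← hsplit (fun i => Function.update ν i₀ (c • ν i₀) i (s i)), Function.update_self, Measure.smul_apply,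
    smul_eq_mul, mul_assoc]
  congr 2
  exact Finset.prod_congr rfl fun i hi => by rw [Function.update_of_ne (Finset.ne_of_mem_erase hi)]

/-- **(H1) the pull-back of a product of Haar measures along `e⁻¹` is a Haar measure on `Γ`** (Mathlib: `Measure.pi` of Haar measures is Haar,
`ContinuousMulEquiv.isHaarMeasure_map`). [cite: Folland1995, §2.2 (2.20)] -/
theorem isHaarMeasure_map_symm_pi (e : Γ ≃ₜ* (∀ i, G i)) (ν : ∀ i, Measure (G i)) [∀ i, (ν i).IsHaarMeasure] [∀ i, SigmaFinite (ν i)] :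
    ((Measure.pi ν).map ⇑e.symm).IsHaarMeasure :=
  ContinuousMulEquiv.isHaarMeasure_map (Measure.pi ν) e.symm

omit [∀ i, IsTopologicalGroup (G i)] [IsTopologicalGroup Γ] in
/-- **(H2) `νΓ.map e = ⊗ ν ↔ νΓ = (⊗ ν).map e⁻¹`** (measurable-equivalence bookkeeping). [folklore] -/
theorem map_eq_pi_iff (e : Γ ≃ₜ* (∀ i, G i)) (νΓ : Measure Γ) (ν : ∀ i, Measure (G i)) :
    νΓ.map ⇑e = Measure.pi ν ↔ νΓ = (Measure.pi ν).map ⇑e.symm := by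
  have hc : (e.toHomeomorph.toMeasurableEquiv : Γ → ∀ i, G i) = ⇑e := rfl
  have hcs : (e.toHomeomorph.toMeasurableEquiv.symm : (∀ i, G i) → Γ) = ⇑e.symm := rfl
  constructor
  · intro h
    rw [← h, ← hc, ← hcs, MeasurableEquiv.map_symm_map]
  · intro h
    rw [h, ← hc, ← hcs, MeasurableEquiv.map_map_symm]

/-- **(H3) EVERY HAAR MEASURE ON `Γ` IS A PRODUCT OF HAAR MEASURES ALONG `e`**: `νΓ.map e = ⊗ᵢ ν′ᵢ` with all `ν′ᵢ` Haar — the push-forward `νΓ.map e` and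
`⊗ νᵢ` are two Haar measures on the second-countable locally compact group `Π G i`, hence `νΓ.map e = c • ⊗ νᵢ` with `0 < c < ∞` (Mathlib
`isMulLeftInvariant_eq_smul`, `haarScalarFactor_pos_of_isHaarMeasure`), and `c • ⊗ νᵢ = ⊗ (update ν i₀ (c • ν i₀))`. [cite: Folland1995, §2.2 Thm. 2.20] -/
theorem exists_pi_eq_map_of_isHaarMeasure [∀ i, LocallyCompactSpace (G i)] [Nonempty ι] (e : Γ ≃ₜ* (∀ i, G i))
    (νΓ : Measure Γ) [νΓ.IsHaarMeasure] (ν : ∀ i, Measure (G i)) [∀ i, (ν i).IsHaarMeasure] [∀ i, SigmaFinite (ν i)] :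
    ∃ ν' : ∀ i, Measure (G i), (∀ i, (ν' i).IsHaarMeasure) ∧ νΓ.map ⇑e = Measure.pi ν' := by
  obtain ⟨i₀⟩ := ‹Nonempty ι›
  haveI : (νΓ.map ⇑e).IsHaarMeasure := ContinuousMulEquiv.isHaarMeasure_map νΓ e
  set c : ℝ≥0 := haarScalarFactor (νΓ.map ⇑e) (Measure.pi ν) with hc
  have hcpos : 0 < c := haarScalarFactor_pos_of_isHaarMeasure _ _
  have heq : νΓ.map ⇑e = (c : ℝ≥0∞) • Measure.pi ν := by
    rw [← ENNReal.smul_def]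
    exact isMulLeftInvariant_eq_smul (νΓ.map ⇑e) (Measure.pi ν)
  have hc0 : (c : ℝ≥0∞) ≠ 0 := ENNReal.coe_ne_zero.2 hcpos.ne'
  haveI hH : ∀ i, (Function.update ν i₀ ((c : ℝ≥0∞) • ν i₀) i).IsHaarMeasure := fun i => by
    by_cases h : i = i₀
    · subst h; rw [Function.update_self]; exact IsHaarMeasure.smul _ hc0 ENNReal.coe_ne_top
    · rw [Function.update_of_ne h]; infer_instance
  refine ⟨Function.update ν i₀ ((c : ℝ≥0∞) • ν i₀), hH, ?_⟩
  rw [heq, pi_update_smul]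

/-- **(H5) right invariance is transported along `e⁻¹`**: if each `νᵢ` is right-invariant then so is `(⊗ νᵢ).map e⁻¹`. [cite: BourbakiINT7, Ch. VII §1 no. 2] -/
theorem isMulRightInvariant_map_symm_pi (e : Γ ≃ₜ* (∀ i, G i)) (ν : ∀ i, Measure (G i)) [∀ i, SigmaFinite (ν i)]
    [∀ i, (ν i).IsMulRightInvariant] : ((Measure.pi ν).map ⇑e.symm).IsMulRightInvariant := by
  constructor
  intro g
  have hm : Measurable (⇑e.symm) := e.symm.continuous.measurable
  rw [Measure.map_map (measurable_mul_const g) hm]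
  have hfun : ((fun x => x * g) ∘ ⇑e.symm) = (⇑e.symm ∘ fun y => y * e g) := by
    funext y
    simp only [Function.comp_apply, map_mul, ContinuousMulEquiv.symm_apply_apply]
  rw [hfun, ← Measure.map_map hm (measurable_mul_const (e g)), map_mul_right_eq_self]

end Generic

/-! ## §2 The archimedean unitary group of a CM hermitian space along its complex places: `e := archPiEquivCM L H` -/

section Arch

variable (L : Type) [Field L] [NumberField L] [IsCMField L] {N : ℕ} (H : Matrix (Fin N) (Fin N) L)
  [MeasurableSpace ↥(arch (↥(maximalRealSubfield L)) L (IsCMField.complexConj L) N H)]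
  [BorelSpace ↥(arch (↥(maximalRealSubfield L)) L (IsCMField.complexConj L) N H)]
  [∀ w : {w : InfinitePlace L // IsComplex w}, MeasurableSpace ↥(archLocal L N H w)]
  [∀ w : {w : InfinitePlace L // IsComplex w}, BorelSpace ↥(archLocal L N H w)]

/-- **(H4a) `(⊗_w ν_w).map (archPiEquivCM L H)⁻¹` is a Haar measure on `U(H)(L ⊗ ℝ)`** for Haar measures `ν_w` on the complex-place factors.
[cite: Folland1995, §2.2 (2.20)] -/
theorem isHaarMeasure_map_archPiEquivCM_symm_pi [∀ w : {w : InfinitePlace L // IsComplex w}, SecondCountableTopology ↥(archLocal L N H w)]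
    (νw : ∀ w : {w : InfinitePlace L // IsComplex w}, Measure ↥(archLocal L N H w)) [∀ w, (νw w).IsHaarMeasure] [∀ w, SigmaFinite (νw w)] :
    ((Measure.pi νw).map ⇑(archPiEquivCM L H (N := N)).symm).IsHaarMeasure :=
  isHaarMeasure_map_symm_pi (archPiEquivCM L H (N := N)) νw

/-- **(H4b) `ν.map (archPiEquivCM L H) = ⊗ ν_w ↔ ν = (⊗ ν_w).map (archPiEquivCM L H)⁻¹`**. [folklore] -/
theorem map_archPiEquivCM_eq_pi_iff [∀ w : {w : InfinitePlace L // IsComplex w}, SecondCountableTopology ↥(archLocal L N H w)]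
    (ν : Measure ↥(arch (↥(maximalRealSubfield L)) L (IsCMField.complexConj L) N H))
    (νw : ∀ w : {w : InfinitePlace L // IsComplex w}, Measure ↥(archLocal L N H w)) :
    ν.map ⇑(archPiEquivCM L H (N := N)) = Measure.pi νw ↔ ν = (Measure.pi νw).map ⇑(archPiEquivCM L H (N := N)).symm :=
  map_eq_pi_iff (archPiEquivCM L H (N := N)) ν νw

/-- **(H4c) EVERY HAAR MEASURE ON `U(H)(L ⊗ ℝ)` IS A PRODUCT OF HAAR MEASURES OVER THE COMPLEX PLACES along ★ `archPiEquivCM`** — the hypothesis of the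
S2 tensor letters' `G`-instance (`ArchTensorRepLettersG`) for an arbitrary Haar `ν` (second countability and local compactness of the factors
`U(σ_w H)(ℂ)` as instance binders — closed subgroups of `GL_N(ℂ)`, but the tree has no such instances; `L` is totally complex, so the index type is non-empty). [cite: Folland1995, §2.2 Thm. 2.20] -/
theorem exists_pi_eq_map_archPiEquivCM [∀ w : {w : InfinitePlace L // IsComplex w}, SecondCountableTopology ↥(archLocal L N H w)]
    [∀ w : {w : InfinitePlace L // IsComplex w}, LocallyCompactSpace ↥(archLocal L N H w)]
    (ν : Measure ↥(arch (↥(maximalRealSubfield L)) L (IsCMField.complexConj L) N H)) [ν.IsHaarMeasure]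
    (νw : ∀ w : {w : InfinitePlace L // IsComplex w}, Measure ↥(archLocal L N H w)) [∀ w, (νw w).IsHaarMeasure] [∀ w, SigmaFinite (νw w)] :
    ∃ νw' : ∀ w : {w : InfinitePlace L // IsComplex w}, Measure ↥(archLocal L N H w),
      (∀ w, (νw' w).IsHaarMeasure) ∧ ν.map ⇑(archPiEquivCM L H (N := N)) = Measure.pi νw' :=
  -- a CM field is totally complex, so the index type of complex places is non-empty
  haveI : Nonempty {w : InfinitePlace L // IsComplex w} := ⟨⟨Classical.arbitrary _, IsTotallyComplex.isComplex _⟩⟩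
  exists_pi_eq_map_of_isHaarMeasure (archPiEquivCM L H (N := N)) ν νw

/-- **(H4d) right invariance along `(archPiEquivCM L H)⁻¹`**. [cite: BourbakiINT7, Ch. VII §1 no. 2] -/
theorem isMulRightInvariant_map_archPiEquivCM_symm_pi [∀ w : {w : InfinitePlace L // IsComplex w}, SecondCountableTopology ↥(archLocal L N H w)]
    (νw : ∀ w : {w : InfinitePlace L // IsComplex w}, Measure ↥(archLocal L N H w)) [∀ w, SigmaFinite (νw w)] [∀ w, (νw w).IsMulRightInvariant] :
    ((Measure.pi νw).map ⇑(archPiEquivCM L H (N := N)).symm).IsMulRightInvariant :=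
  isMulRightInvariant_map_symm_pi (archPiEquivCM L H (N := N)) νw

end Arch


end Summit.HodgeConjecture.HodgeConjecture.R90.S2

end
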